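import Summits.KontsevichZagierPeriods.KontsevichZagierPeriods.Theses.HodgeColevel
import Literature.NumberTheory.Transcendental.KZKernelConjectureForms

/-!
# `CoresOfSummit` (stmt-KontsevichZagierPeriods-6183, route HodgeColevel) — proof

Honesty certificate of route HodgeColevel: the summit `KontsevichZagierPeriods` implies both open
cores of the route, `DegreeCompression` (equal values of KZ-rational representations ⇒ the same
dimensions are reachable by moves) and `SameDegreeConjecture` (two incompressible representations
of the same dimension with the same value are KZ-equivalent). Pure logic over route declarations:
`DegreeCompression` follows from the summit's two-representation form by symmetry/transitivity of
`KZ.Equivalent`; `SameDegreeConjecture` follows from the `ℚ`-semialgebraic two-representation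
form, which the summit gives through
`Literature.NumberTheory.Transcendental.kzPeriodConjecture'_iff_isRational` (proved in tree).
Planner-proved glue (Sketch.lean of the HodgeColevel planner), landed by lead c10 of crux
stmt-KontsevichZagierPeriods-9129 (banking). No definitions.
-/

namespace Summit.KontsevichZagierPeriods.HodgeColevel

open Summit.KontsevichZagierPeriods.KontsevichZagierPeriods.Theses.HodgeColevel

/-- **`CoresOfSummit`** (route HodgeColevel, stmt-KontsevichZagierPeriods-6183): the summit
`KontsevichZagierPeriods` implies `DegreeCompression ∧ SameDegreeConjecture`. Proof: for
`DegreeCompression`, the summit makes the two KZ-rational representations `r`, `r'` of equal value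
KZ-equivalent, so any `s` equivalent to `r` is equivalent to `r'` (`KZ.Equivalent.symm`,
`KZ.Equivalent.trans`); for `SameDegreeConjecture`, the summit unfolds (`KontsevichZagierPeriods_iff`)
to the right-hand side of `kzPeriodConjecture'_iff_isRational`, whose left-hand side
`KZPeriodConjecture'` makes any two representations of equal value KZ-equivalent (the
incompressibility hypotheses are not needed). [folklore] -/
theorem coresOfSummit_proof :
    Summit.KontsevichZagierPeriods.KontsevichZagierPeriods.Theses.HodgeColevel.CoresOfSummit := by
  intro h
  refine ⟨?_, ?_⟩
  · intro n m r r' hr hr' hv k hk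
    obtain ⟨s, hs⟩ := hk
    exact ⟨s, (KontsevichZagierPeriods_iff.mp h r r' hr hr' hv).symm.trans hs⟩
  · intro d r r' _ _ hv
    exact Literature.NumberTheory.Transcendental.kzPeriodConjecture'_iff_isRational.mpr
      (KontsevichZagierPeriods_iff.mp h) r r' hv

end Summit.KontsevichZagierPeriods.HodgeColevel
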